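import Summits.KontsevichZagierPeriods.KontsevichZagierPeriods.Theses.TerasomaMultiplication
import Summits.KontsevichZagierPeriods.KontsevichZagierPeriods.Theorems.CompleteModGammaSector.Negative.LoadBearing
import Summits.KontsevichZagierPeriods.KontsevichZagierPeriods.Theorems.TerasomaMultiplicationCompleteModGammaSectorStubStokesBoxAlg
import Summits.KontsevichZagierPeriods.KontsevichZagierPeriods.Theorems.TerasomaMultiplicationCompleteModGammaSectorTransportOfStokesBox
import Summits.KontsevichZagierPeriods.KontsevichZagierPeriods.Theorems.TerasomaMultiplicationCompleteModGammaSectorStubElliottSemialgebraic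
import Summits.KontsevichZagierPeriods.KontsevichZagierPeriods.Theorems.TerasomaMultiplicationCompleteModGammaSectorStubElliottCertificate
import Summits.KontsevichZagierPeriods.KontsevichZagierPeriods.Theorems.TerasomaMultiplicationCompleteModGammaSectorStubElliottPotentialT
import Summits.KontsevichZagierPeriods.KontsevichZagierPeriods.Theorems.TerasomaMultiplicationCompleteModGammaSectorStubElliottPotentialU
import Summits.KontsevichZagierPeriods.KontsevichZagierPeriods.Theorems.TerasomaMultiplicationCompleteModGammaSectorStubElliottIntegrable
import Literature.NumberTheory.Transcendental.KZProductIdeal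
import Literature.NumberTheory.Transcendental.KZCalculusProofs
import Literature.NumberTheory.Transcendental.SemialgebraicRpow

/-!
# `CompleteModGammaSector` (stmt-KontsevichZagierPeriods-14233) — line `cusp-transport-to-the-beta-world`

Crux proof SKELETON of the line lead (continuation seat c2), card
`Cruxes/CompleteModGammaSector/Ideas/cusp-transport-to-the-beta-world.md`.

The crux (Conjecture 1 of Kontsevich–Zagier for the Γ-enlarged calculus; kernel form
`ker eval ≤ sector`, `CompleteModGammaSectorNegative.completeModGammaSector_iff_ker_le`, landed) is
reduced to

* the ABSOLUTE sector theorem `elliottToCusp` (sorry-free below MODULO the five registered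
  `stub_elliott*` stubs): for rational `0 < a < 1`, `1 - a < c` and a real algebraic modulus
  `z₁ ∈ (0,1)`, the Elliott–Legendre combination
  `[(0,1)², e(t;z₁)k(u;1−z₁) + k(t;z₁)e(u;1−z₁) − k(t;z₁)k(u;1−z₁)]`
  (`k(t;z) = t^{−a}(1−t)^{c+a−2}(1−zt)^{−a}`, `e(t;z) = k(t;z)(1−zt)`; `a = ½`, `c = 1` is Legendre's
  relation `EK' + KE' − KK' = π/2` in Euler form) is KZ-equivalent to the bare Beta 2-cube
  `[(0,1)², t^{−a}(1−t)^{c+a−2} u^{−a}(1−u)^{c−1}]` (its cusp fibre `z = 0`): ONE closed-band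
  Newton–Leibniz move in the modulus `s ∈ [0, z₁]` with the family `F` as its own primitive, and
  the divergence certificate `∂_s F = ∂_t P + ∂_u Q` (`P`, `Q` vanishing on the faces) discharged
  by two box-Stokes moves — i.e. the landed ENGINE
  `CompleteModGammaSectorEngine.certificateTransport_of_stokesBoxBand` (p-landed, E2') fed with
  `CompleteModGammaSectorEngine.stub_stokesBoxBand` (landed, E1'); the stubs are exactly the
  engine's analytic side conditions for this family:
  `stub_elliottSemialgebraic` (ℚ-semialgebraicity of `F`, `P`, `Q`, `∂_tP`, `∂_uQ`),
  `stub_elliottCertificate` (continuity of `F` in `s` on `[0,z₁]`, `∂_sF = ∂_tP + ∂_uQ`),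
  `stub_elliottPotentialT` / `stub_elliottPotentialU` (fibre regularity and face-vanishing of `P`,
  `Q`), `stub_elliottIntegrable` (absolute integrability of `∂_tP`, `∂_uQ` on the open band — the
  cusp estimate);
* the RESIDUAL `stub_residualOffElliott` (GPC-strength, crux-implied, honest remainder of the
  line): `ker eval ≤ sector ⊔ closure{Elliott–cusp pair differences and their left multiples}`;

composed in `CompleteModGammaSector_of`: each generator `[r] − [ρ]` is a relation by
`elliottToCusp`, left multiples by `KZ.mul_mem_relations_left_holds`, so `closure{…} ≤ relations ≤
sector` and the crux follows BY NAME. No definition is introduced (every integrand is written out).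

References: Kontsevich–Zagier 2001 §1.2 (rules), §1.1; Anderson–Vamanamurthy–Vuorinen (AQVV 2000)
Cor. 3.13 (5) (Elliott's identity); Andrews–Askey–Roy 1999 Thm 3.2.8 (Legendre via the
hypergeometric Wronskian).
-/

noncomputable section

-- `Summit.KontsevichZagierPeriods.KontsevichZagierPeriods.…` is the tree's mandated layout (single-conjunct summit).
set_option linter.dupNamespace false

namespace Summit.KontsevichZagierPeriods.KontsevichZagierPeriods.CompleteModGammaSectorCuspLine

open MeasureTheory Set
open Literature.NumberTheory.Transcendental
open Literature.NumberTheory.Transcendental.KZ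
open Summit.KontsevichZagierPeriods.KontsevichZagierPeriods.Theses.TerasomaMultiplication
  (CompleteModGammaSector)
open Summit.KontsevichZagierPeriods.CompleteModGammaSectorNegative
  (sector completeModGammaSector_iff_ker_le)
open Summit.KontsevichZagierPeriods.KontsevichZagierPeriods.CompleteModGammaSectorEngine
  (stub_stokesBoxBand certificateTransport_of_stokesBoxBand)

/-! ## Registered stubs — the five analytic stubs `stub_elliottSemialgebraic` (p102760),
`stub_elliottCertificate` (p102761), `stub_elliottPotentialT` (p102154), `stub_elliottPotentialU` (p102764),
`stub_elliottIntegrable` (p102758) are LANDED and imported; only the residual remains.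

Notation of the docstrings (all functions of `z : Fin 3 → ℝ`, `t = z 0`, `u = z 1`, `s = z 2`;
`a c : ℚ`, real algebraic `z₁ ∈ (0,1)`):
* family `F z = t^{−a}(1−t)^{c+a−2}(1−st)^{−a} · u^{−a}(1−u)^{c+a−2}(1−(1−s)u)^{−a} · (1 − st − (1−s)u)`;
* potentials `P z = t^{1−a}(1−t)^{c+a−1}(1−st)^{−a} · u^{1−a}(1−u)^{c+a−2}(1−(1−s)u)^{−a}`,
  `Q z = −t^{1−a}(1−t)^{c+a−2}(1−st)^{−a} · u^{1−a}(1−u)^{c+a−1}(1−(1−s)u)^{−a}`;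
* their derivatives `g₀ = ∂_t P`, `g₁ = ∂_u Q` (written out: common factor times a polynomial);
* open band `B₀ = (0,1)² × (0,z₁)`, `s`-closed band `B = (0,1)² × [0,z₁]`. -/

/-- STUB 6 (RESIDUAL `ResidualOffElliott`; OPEN, GPC-strength, crux-implied): every value-zero
formal combination lies in the Γ-sector enlarged by the Elliott–cusp pair differences
`[r] − [ρ]` (`r` the Elliott–Legendre representation at a real algebraic modulus, `ρ` its cusp
Beta 2-cube) and their left multiples — Conjecture 1 modulo Γ and modulo the Elliott sector.
[cite: KontsevichZagier2001, §1.2 Conjecture 1] -/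
theorem stub_residualOffElliott : eval.ker ≤ sector ⊔ AddSubgroup.closure {d : FormalRep | ∃ (a c : ℚ) (z₁ : ℝ) (r ρ : IntegralRep 2), (0 < a ∧ a < 1 ∧ 1 - a < c) ∧ (0 < z₁ ∧ z₁ < 1 ∧ IsAlgebraic ℚ z₁) ∧ r.domain = {x | ∀ i, x i ∈ Set.Ioo (0:ℝ) 1} ∧ Set.EqOn r.integrand (fun x => (x 0) ^ (-(a : ℝ)) * (1 - x 0) ^ ((c : ℝ) + (a : ℝ) - 2) * (1 - z₁ * x 0) ^ (1 - (a : ℝ)) * ((x 1) ^ (-(a : ℝ)) * (1 - x 1) ^ ((c : ℝ) + (a : ℝ) - 2) * (1 - (1 - z₁) * x 1) ^ (-(a : ℝ))) + (x 0) ^ (-(a : ℝ)) * (1 - x 0) ^ ((c : ℝ) + (a : ℝ) - 2) * (1 - z₁ * x 0) ^ (-(a : ℝ)) * ((x 1) ^ (-(a : ℝ)) * (1 - x 1) ^ ((c : ℝ) + (a : ℝ) - 2) * (1 - (1 - z₁) * x 1) ^ (1 - (a : ℝ))) - (x 0) ^ (-(a : ℝ)) * (1 - x 0) ^ ((c : ℝ)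 + (a : ℝ) - 2) * (1 - z₁ * x 0) ^ (-(a : ℝ)) * ((x 1) ^ (-(a : ℝ)) * (1 - x 1) ^ ((c : ℝ) + (a : ℝ) - 2) * (1 - (1 - z₁) * x 1) ^ (-(a : ℝ)))) r.domain ∧ ρ.domain = {x | ∀ i, x i ∈ Set.Ioo (0:ℝ) 1} ∧ Set.EqOn ρ.integrand (fun x => (x 0) ^ (-(a : ℝ)) * (1 - x 0) ^ ((c : ℝ) + (a : ℝ) - 2) * ((x 1) ^ (-(a : ℝ)) * (1 - x 1) ^ ((c : ℝ) - 1))) ρ.domain ∧ (d = of r - of ρ ∨ ∃ w : FormalRep, d = w * (of r - of ρ))} := by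
  sorry

/-! ## Glue (sorry-free): the sector theorem from the engine -/

/-- Coordinates of `Fin.snoc x s : Fin 3 → ℝ`. [folklore] -/
theorem snoc_apply_zero (x : Fin 2 → ℝ) (s : ℝ) : (Fin.snoc x s : Fin 3 → ℝ) 0 = x 0 := rfl

/-- Coordinates of `Fin.snoc x s : Fin 3 → ℝ`. [folklore] -/
theorem snoc_apply_one (x : Fin 2 → ℝ) (s : ℝ) : (Fin.snoc x s : Fin 3 → ℝ) 1 = x 1 := rfl

/-- Coordinates of `Fin.snoc x s : Fin 3 → ℝ`. [folklore] -/
theorem snoc_apply_two (x : Fin 2 → ℝ) (s : ℝ) : (Fin.snoc x s : Fin 3 → ℝ) 2 = s := rfl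

/-- **Cusp transport lands the Elliott–Legendre sector on the Beta 2-cube** (`ElliottToCusp`,
ABSOLUTE): for rational `0 < a < 1`, `1 − a < c` and a real algebraic modulus `z₁ ∈ (0,1)`, the
representation `[(0,1)², e(t;z₁)k(u;1−z₁) + k(t;z₁)e(u;1−z₁) − k(t;z₁)k(u;1−z₁)]` is KZ-equivalent to
the cusp cube `[(0,1)², t^{−a}(1−t)^{c+a−2}u^{−a}(1−u)^{c−1}]`: the engine
`certificateTransport_of_stokesBoxBand stub_stokesBoxBand` (one Newton–Leibniz move in the modulus
over the closed band `[0, z₁]`, two box-Stokes moves) applied to the family `F` with the certificate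
`∂_sF = ∂_tP + ∂_uQ`. [cite: KontsevichZagier2001, §1.2] -/
theorem elliottToCusp : ∀ (a c : ℚ) (z₁ : ℝ), 0 < a → a < 1 → 1 - a < c → 0 < z₁ → z₁ < 1 → IsAlgebraic ℚ z₁ →
    ∀ (r ρ : IntegralRep 2), r.domain = {x | ∀ i, x i ∈ Set.Ioo (0:ℝ) 1} →
      Set.EqOn r.integrand (fun x => (x 0) ^ (-(a : ℝ)) * (1 - x 0) ^ ((c : ℝ) + (a : ℝ) - 2) * (1 - z₁ * x 0) ^ (1 - (a : ℝ)) * ((x 1) ^ (-(a : ℝ)) * (1 - x 1) ^ ((c : ℝ) + (a : ℝ) - 2) * (1 - (1 - z₁) * x 1) ^ (-(a : ℝ))) + (x 0) ^ (-(a : ℝ)) * (1 - x 0) ^ ((c : ℝ) + (a : ℝ) - 2) * (1 - z₁ * x 0) ^ (-(a : ℝ)) * ((x 1) ^ (-(a : ℝ)) * (1 - x 1) ^ ((c : ℝ) + (a : ℝ) - 2) * (1 - (1 - z₁) * x 1) ^ (1 - (a : ℝ))) - (x 0) ^ (-(a : ℝ)) * (1 - x 0) ^ ((c : ℝ) + (a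 : ℝ) - 2) * (1 - z₁ * x 0) ^ (-(a : ℝ)) * ((x 1) ^ (-(a : ℝ)) * (1 - x 1) ^ ((c : ℝ) + (a : ℝ) - 2) * (1 - (1 - z₁) * x 1) ^ (-(a : ℝ)))) r.domain →
      ρ.domain = {x | ∀ i, x i ∈ Set.Ioo (0:ℝ) 1} →
      Set.EqOn ρ.integrand (fun x => (x 0) ^ (-(a : ℝ)) * (1 - x 0) ^ ((c : ℝ) + (a : ℝ) - 2) * ((x 1) ^ (-(a : ℝ)) * (1 - x 1) ^ ((c : ℝ) - 1))) ρ.domain →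
      Equivalent r ρ := by
  intro a c z₁ ha0 ha1 hac hz0 hz1 hzalg r ρ hrd hri hρd hρi
  -- the family, the potentials and the divergence
  set F : (Fin 3 → ℝ) → ℝ := fun z => (z 0) ^ (-(a : ℝ)) * (1 - z 0) ^ ((c : ℝ) + (a : ℝ) - 2) * (1 - z 2 * z 0) ^ (-(a : ℝ)) * ((z 1) ^ (-(a : ℝ)) * (1 - z 1) ^ ((c : ℝ) + (a : ℝ) - 2) * (1 - (1 - z 2) * z 1) ^ (-(a : ℝ))) * (1 - z 2 * z 0 - (1 - z 2) * z 1) with hF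
  set P : (Fin 3 → ℝ) → ℝ := fun z => (z 0) ^ (1 - (a : ℝ)) * (1 - z 0) ^ ((c : ℝ) + (a : ℝ) - 1) * (1 - z 2 * z 0) ^ (-(a : ℝ)) * ((z 1) ^ (1 - (a : ℝ)) * (1 - z 1) ^ ((c : ℝ) + (a : ℝ) - 2) * (1 - (1 - z 2) * z 1) ^ (-(a : ℝ))) with hP
  set Q : (Fin 3 → ℝ) → ℝ := fun z => -((z 0) ^ (1 - (a : ℝ)) * (1 - z 0) ^ ((c : ℝ) + (a : ℝ) - 2) * (1 - z 2 * z 0) ^ (-(a : ℝ)) * ((z 1) ^ (1 - (a : ℝ)) * (1 - z 1) ^ ((c : ℝ) + (a : ℝ) - 1) * (1 - (1 - z 2) * z 1) ^ (-(a : ℝ)))) with hQ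
  set g₀ : (Fin 3 → ℝ) → ℝ := fun z => (z 0) ^ (-(a : ℝ)) * (1 - z 0) ^ ((c : ℝ) + (a : ℝ) - 2) * (1 - z 2 * z 0) ^ (-(a : ℝ) - 1) * ((1 - (a : ℝ)) * (1 - z 0) * (1 - z 2 * z 0) - ((c : ℝ) + (a : ℝ) - 1) * z 0 * (1 - z 2 * z 0) + (a : ℝ) * z 2 * z 0 * (1 - z 0)) * ((z 1) ^ (1 - (a : ℝ)) * (1 - z 1) ^ ((c : ℝ) + (a : ℝ) - 2) * (1 - (1 - z 2) * z 1) ^ (-(a : ℝ))) with hg₀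
  set g₁ : (Fin 3 → ℝ) → ℝ := fun z => -((z 0) ^ (1 - (a : ℝ)) * (1 - z 0) ^ ((c : ℝ) + (a : ℝ) - 2) * (1 - z 2 * z 0) ^ (-(a : ℝ)) * ((z 1) ^ (-(a : ℝ)) * (1 - z 1) ^ ((c : ℝ) + (a : ℝ) - 2) * (1 - (1 - z 2) * z 1) ^ (-(a : ℝ) - 1) * ((1 - (a : ℝ)) * (1 - z 1) * (1 - (1 - z 2) * z 1) - ((c : ℝ) + (a : ℝ) - 1) * z 1 * (1 - (1 - z 2) * z 1) + (a : ℝ) * (1 - z 2) * z 1 * (1 - z 1)))) with hg₁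
  obtain ⟨hFsa, hPsa, hQsa, hg₀sa, hg₁sa⟩ := stub_elliottSemialgebraic a c z₁ ha0 ha1 hac hz0 hz1 hzalg
  have hcert := stub_elliottCertificate a c z₁ ha0 ha1 hac hz0 hz1 hzalg
  have hPT := stub_elliottPotentialT a c z₁ ha0 ha1 hac hz0 hz1 hzalg
  have hQU := stub_elliottPotentialU a c z₁ ha0 ha1 hac hz0 hz1 hzalg
  obtain ⟨hg₀i, hg₁i⟩ := stub_elliottIntegrable a c z₁ ha0 ha1 hac hz0 hz1 hzalg
  -- the engine, applied from the cusp fibre `s = 0` to the fibre `s = z₁`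
  have hE := certificateTransport_of_stokesBoxBand stub_stokesBoxBand 2 0 z₁ F ![g₀, g₁] ![P, Q] ρ r
    hz0 isAlgebraic_zero hzalg hFsa
    (by
      rw [Fin.forall_fin_two]
      exact ⟨hPsa, hQsa⟩)
    (by
      rw [Fin.forall_fin_two]
      exact ⟨hg₀sa, hg₁sa⟩)
    (by
      rw [Fin.forall_fin_two]
      exact ⟨hg₀i, hg₁i⟩)
    (by
      intro x hx
      refine ⟨(hcert x hx).1, fun s hs => ?_⟩
      have h := (hcert x hx).2 s hs
      simpa only [Fin.sum_univ_two, Matrix.cons_val_zero, Matrix.cons_val_one] using h)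
    (by
      rw [Fin.forall_fin_two]
      exact ⟨hPT, hQU⟩)
    hρd
    (by
      -- the cusp fibre `F(x, 0)` is the bare Beta 2-cube
      intro x hx
      rw [hρd] at hx
      have hx1 := hx 1
      have h1u : 0 < 1 - x 1 := by linarith [hx1.2]
      rw [hρi (by rw [hρd]; exact hx)]
      simp only [hF, snoc_apply_zero, snoc_apply_one, snoc_apply_two, zero_mul, sub_zero,
        Real.one_rpow, mul_one, one_mul]
      have hsplit : (1 - x 1) ^ ((c : ℝ) - 1) =
          (1 - x 1) ^ ((c : ℝ) + (a : ℝ) - 2) * (1 - x 1) ^ (-(a : ℝ)) * (1 - x 1) := by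
        rw [← Real.rpow_add h1u, ← Real.rpow_add_one h1u.ne']
        congr 1
        ring
      rw [hsplit]
      ring)
    hrd
    (by
      -- the fibre `F(x, z₁)` is the Elliott–Legendre combination
      intro x hx
      rw [hrd] at hx
      have hx0 := hx 0
      have hx1 := hx 1
      have h1t : 0 < 1 - z₁ * x 0 := by nlinarith [hx0.1, hx0.2]
      have h1u : 0 < 1 - (1 - z₁) * x 1 := by nlinarith [hx1.1, hx1.2]
      rw [hri (by rw [hrd]; exact hx)]
      simp only [hF, snoc_apply_zero, snoc_apply_one, snoc_apply_two]
      have e1 : (1 - z₁ * x 0) ^ (1 - (a : ℝ)) = (1 - z₁ * x 0) ^ (-(a : ℝ)) * (1 - z₁ * x 0) := by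
        rw [← Real.rpow_add_one h1t.ne']
        congr 1
        ring
      have e2 : (1 - (1 - z₁) * x 1) ^ (1 - (a : ℝ)) =
          (1 - (1 - z₁) * x 1) ^ (-(a : ℝ)) * (1 - (1 - z₁) * x 1) := by
        rw [← Real.rpow_add_one h1u.ne']
        congr 1
        ring
      rw [e1, e2]
      ring)
  exact hE.symm

/-! ## Glue (sorry-free): every Elliott–cusp generator is a relation; composition -/

/-- The Elliott–cusp generators (pair differences and their left multiples) are relations:
`elliottToCusp` and `relations` is a left ideal (`KZ.mul_mem_relations_left_holds`).
[cite: KontsevichZagier2001, §1.2] -/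
theorem closure_elliott_le_relations :
    AddSubgroup.closure {d : FormalRep | ∃ (a c : ℚ) (z₁ : ℝ) (r ρ : IntegralRep 2), (0 < a ∧ a < 1 ∧ 1 - a < c) ∧ (0 < z₁ ∧ z₁ < 1 ∧ IsAlgebraic ℚ z₁) ∧ r.domain = {x | ∀ i, x i ∈ Set.Ioo (0:ℝ) 1} ∧ Set.EqOn r.integrand (fun x => (x 0) ^ (-(a : ℝ)) * (1 - x 0) ^ ((c : ℝ) + (a : ℝ) - 2) * (1 - z₁ * x 0) ^ (1 - (a : ℝ)) * ((x 1) ^ (-(a : ℝ)) * (1 - x 1) ^ ((c : ℝ) + (a : ℝ) - 2) * (1 - (1 - z₁) * x 1) ^ (-(a : ℝ))) + (x 0) ^ (-(a : ℝ)) * (1 - x 0) ^ ((c : ℝ) + (a : ℝ) - 2) * (1 - z₁ * x 0) ^ (-(a : ℝ)) * ((x 1) ^ (-(a : ℝ)) * (1 - x 1) ^ ((c : ℝ) + (a : ℝ) - 2) * (1 - (1 - z₁) * x 1) ^ (1 - (a : ℝ))) - (x 0) ^ (-(a : ℝ)) * (1 - x 0) ^ ((c : ℝ) + (a : ℝ)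 - 2) * (1 - z₁ * x 0) ^ (-(a : ℝ)) * ((x 1) ^ (-(a : ℝ)) * (1 - x 1) ^ ((c : ℝ) + (a : ℝ) - 2) * (1 - (1 - z₁) * x 1) ^ (-(a : ℝ)))) r.domain ∧ ρ.domain = {x | ∀ i, x i ∈ Set.Ioo (0:ℝ) 1} ∧ Set.EqOn ρ.integrand (fun x => (x 0) ^ (-(a : ℝ)) * (1 - x 0) ^ ((c : ℝ) + (a : ℝ) - 2) * ((x 1) ^ (-(a : ℝ)) * (1 - x 1) ^ ((c : ℝ) - 1))) ρ.domain ∧ (d = of r - of ρ ∨ ∃ w : FormalRep, d = w * (of r - of ρ))} ≤ relations := by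
  rw [AddSubgroup.closure_le]
  rintro d ⟨a, c, z₁, r, ρ, ⟨ha0, ha1, hac⟩, ⟨hz0, hz1, hzalg⟩, hrd, hri, hρd, hρi, hd⟩
  have he : of r - of ρ ∈ relations :=
    elliottToCusp a c z₁ ha0 ha1 hac hz0 hz1 hzalg r ρ hrd hri hρd hρi
  rcases hd with rfl | ⟨w, rfl⟩
  · exact he
  · exact mul_mem_relations_left_holds _ w he

/-- **The crux from the registered stubs**: kernel form (`completeModGammaSector_iff_ker_le`), the
residual puts `ker eval` in `sector ⊔ closure{Elliott–cusp generators}`, and the generators are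
relations (`closure_elliott_le_relations`), hence in `sector`.
[cite: KontsevichZagier2001, §1.2 Conjecture 1] -/
theorem CompleteModGammaSector_of : CompleteModGammaSector := by
  refine completeModGammaSector_iff_ker_le.mpr (le_trans stub_residualOffElliott (sup_le le_rfl ?_))
  exact le_trans closure_elliott_le_relations le_sup_left

/-! ## Sorry-free bookkeeping: the residual is crux-implied (no kill short of `¬` summit) -/

/-- The residual is crux-implied (`le_sup_left`). [folklore] -/
theorem residualOffElliott_of_crux (h : CompleteModGammaSector) (S : AddSubgroup FormalRep) :
    eval.ker ≤ sector ⊔ S :=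
  le_trans (completeModGammaSector_iff_ker_le.mp h) le_sup_left

end Summit.KontsevichZagierPeriods.KontsevichZagierPeriods.CompleteModGammaSectorCuspLine
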